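import Summits.QuantumFields.BalabanUV.T4Continuum.Support.ScalarCovariantCTDefects

/-!
# T⁴ programme, SUBSTRATE (shared lattice-gauge analysis library) — LEVEL-FREE EXPONENTIAL DECAY of the covariant scalar averaged
# Green function `G′(U) = S_U⁻¹`, `S_U = D_RᴴD_R + a′·n^d·Q′(U)ᴴQ′(U)` (the typed [B9] (3.24) operator `ScalarCovariantLaplacian.scalarOp`),
# by the Combes–Thomas conjugation — constants depending on `(d, a′, α, τ, card o)` ONLY
# (file 3 of the chain `ScalarCovariantCoercive` → `ScalarCovariantCTDefects` → `ScalarCovariantGreenDecay`)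

Substrate cell `b2b-balaban-substrate-*` (seat p3: covariant Laplacian ∕ Green decay constants), chain «level-free decay of the covariant
scalar averaged Green function» = `ScalarCovariantCoercive` (file 1) → `ScalarCovariantCTDefects` (file 2) → `ScalarCovariantGreenDecay`
(file 3).  The NE rows consume the off-diagonal decay of Bałaban's background-field propagators as a LOCATED HYPOTHESIS
([Balaban1985BackgroundPropagators] = [B9] Thm 3.1 (3.42) p.397 «|(G′(U)λ)(x)| ≤ B₀(L^jη)²e^{−δ₀d(y,y′)}|λ| … δ₀, B₀ depending on d and L
only»; Thm 3.15 (3.187) p.432; rows NE2-P3 (P1-ii), NE1′-P2 WALL E-1, NE3 `hT31`), and the tree's covariant Combes–Thomas certificate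
`Literature.….B9Thm37GlueTorusCovCT` (pv21, comb model) is NOT level-free (its rate degrades with the block side — recorded in the header of
`Support/SliceCovariantModel`).  The chain proves the level-free statement for the Support-typed ONE-REGION covariant scalar operator
`S_U = scalarOp n M a′ R T = D_RᴴD_R + a′·n^d·Q′(U)ᴴQ′(U)` of `Support/ScalarCovariantLaplacian` (p208899) on `Tor (fine n M) × o` (fine
torus of side `n·M_μ`, `n = L^j = η⁻¹`, colour index `o`; transporters `R_μ(x)` and site transports `T(x)` are DATA).

THIS FILE (file 3): **the decay**, from file 1's coercivity `Coercive γ_U S_U` (`γ_U = gammaU d a′ α τ = γ′/2 − (dα)² − a′τ(2+τ)`), its weight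
`rhoS` and rate `kappaU`, file 2's level-free row-defect bound `ctRowDefect_scalarOp_le_uniform` (budget `Jcov (card o) d a′ α τ κ`), and
`Beta.DeltaACombesThomas.combesThomas_pairwise_inv`:
 * **`scalarOp_inv_pairing_decay`** — for `κ ≥ 0` with `Jcov κ < γ_U`, ANY site weight `ρ₀` that is `1/n`-Lipschitz along fine bonds with
   block oscillation `≤ 1`, `v` supported in `{ρ₀ ≤ 0}`, `u` in `{ρ₀ ≥ R′}`: `|⟨u, S_U⁻¹v⟩| ≤ e^{−κR′}/(γ_U − Jcov κ)·‖u‖‖v‖`;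
 * the SET-TO-SET form **`scalarOp_inv_setDecay`** (`v` on `T × o`, `u` at sup-distance `≥ nR′` from `T`, i.e. `≥ R′` blocks) and the ENTRY
   form **`scalarOp_inv_entry_decay`**: `‖S_U⁻¹((x,α),(x′,α′))‖ ≤ e^{−κ·dist_∞(x,x′)/n}/(γ_U − Jcov κ)` — decay in the UNIT-LATTICE distance
   `dist_∞/n = |x − x′|`;
 * the closed form **`scalarOp_inv_entry_decay_explicit`**: in the small-field regime `γ_U > 0`, for EVERY level `n = L^j`, every torus with
   `n·M_μ ≥ 2`, all data with `‖n(R − 1)‖ ≤ α`, `‖T − 1‖ ≤ τ`, and all entries,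
   `‖S_U⁻¹((x,α),(x′,α′))‖ ≤ (2/γ_U)·e^{−κ_U·dist_∞(x,x′)/n}`, `κ_U = kappaU (card o) d a′ α τ > 0` — the quantifier shape of the printed
   «δ₀, B₀ depending on d only» with `δ₀ ↔ κ_U(d, a′, α, τ, card o)`, `B₀ ↔ 2/γ_U`.

HONEST FRAMING (T4-DAG p. 1).  MODEL level: one region (no `Λ_j`, no Dirichlet holes), GLOBAL small field (`α`, `τ` are
hypotheses on the data `R`, `T`), finite torus, ℓ²-pairing ∕ matrix-entry norms (no sup-norm∕Hölder (3.43)–(3.45), no derivative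
entries `∇_UG′`, `G′∇_U*` — successors), route = Combes–Thomas (OURS; print's §3 route is the random-walk expansion); constants
OURS and crude.  NOT [B9] Thm 3.1 as printed; nothing printed is a hypothesis; no `def … : Prop` fact; spine 0/9 unchanged; NOT
infinite volume ∕ mass gap ∕ Clay.  HONEST DEPENDENCY: continuum YM on T⁴ ⇐ BetaPertH ∧ nine spine estimates (0/9 proved);
BetaPertH ⇐ (D1) ∧ (D4) ∧ CAP+tail; G-an2-4 gates asym, D1 and NE2/3/4.  ABSOLUTE RULE kept; no `sorry`.
-/

noncomputable section

open scoped BigOperators ComplexConjugate Matrix Matrix.Norms.L2Operator Kronecker ComplexOrder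

namespace Summit.QuantumFields.BalabanUV.T4Continuum.ScalarCovariantGreenDecay

open Literature.MathematicalPhysics.QuantumFieldTheory.Balaban1983to89.B5Prop11Plancherel (Tor fine unitVec)
open Literature.MathematicalPhysics.QuantumFieldTheory.Balaban1983to89.B5Blocks16 (blockOf)
open Literature.MathematicalPhysics.QuantumFieldTheory.Balaban1983to89.B5Prop11Lower (nsq nsq_nonneg)
open Literature.MathematicalPhysics.QuantumFieldTheory.Balaban1983to89.Beta.DeltaACombesThomas (combesThomas_pairwise_inv)
open Literature.MathematicalPhysics.QuantumFieldTheory.Balaban1983to89.Beta.TorusG0Decay (ldist ldist_self)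
open Literature.MathematicalPhysics.QuantumFieldTheory.Balaban1983to89.Beta.CombesThomasFormOp (distTo le_distTo distTo_le_zero_of_mem)
open Summit.QuantumFields.BalabanUV.T4Continuum
open Summit.QuantumFields.BalabanUV.T4Continuum.ScalarCovariantLaplacian
open Summit.QuantumFields.BalabanUV.T4Continuum.ScalarCovariantCoercive
open Summit.QuantumFields.BalabanUV.T4Continuum.ScalarCovariantCTDefects

variable {d : ℕ} {o : Type*} [Fintype o] [DecidableEq o]
variable (n : ℕ) [NeZero n] (M : Fin d → ℕ) [hM : ∀ μ, NeZero (M μ)]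

variable {a' : ℝ} {R : Fin d → (Tor (fine n M) → Matrix o o ℂ)} {T : Tor (fine n M) → Matrix o o ℂ} {α τ : ℝ}

/-! ## §1 The pairing form -/

/-- **LEVEL-FREE COMBES–THOMAS DECAY OF `G′(U) = S_U⁻¹`, PAIRING FORM.**  For `κ ≥ 0` with `Jcov (card o) d a′ α τ κ < γ_U`, any site
weight `ρ₀` that is `1/n`-Lipschitz along fine bonds with block oscillation `≤ 1`, `v` supported in `{ρ₀ ≤ 0}` and `u` in `{R′ ≤ ρ₀}`:
`|⟨u, S_U⁻¹v⟩| ≤ e^{−κR′}/(γ_U − Jcov κ)·‖u‖‖v‖` — every constant free of `n = L^j` and of the torus `M`.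
[cite: Balaban1985BackgroundPropagators, Thm 3.1 (3.42) p.397 (ℓ²-pairing shadow of the first entry, one region; route ours)] [folklore] -/
theorem scalarOp_inv_pairing_decay (ha' : 0 < a') (hα : 0 ≤ α) (hτ : 0 ≤ τ)
    (hR : ∀ μ x, ‖connS (fine n M) ((n : ℕ) : ℂ) R μ x‖ ≤ α) (hT : ∀ x, ‖T x - 1‖ ≤ τ)
    {ρ₀ : Tor (fine n M) → ℝ} (hlip : ∀ x ν, |ρ₀ (x + unitVec (fine n M) ν) - ρ₀ x| ≤ 1 / n)
    (hosc : ∀ x x', blockOf n M x = blockOf n M x' → |ρ₀ x - ρ₀ x'| ≤ 1)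
    {κ R' : ℝ} (hκ : 0 ≤ κ) (hJ : Jcov (Fintype.card o) d a' α τ κ < gammaU d a' α τ)
    {u v : Tor (fine n M) × o → ℂ} (hu : ∀ e, u e ≠ 0 → R' ≤ ρ₀ e.1) (hv : ∀ e, v e ≠ 0 → ρ₀ e.1 ≤ 0) :
    ‖star u ⬝ᵥ ((scalarOp n M a' R T)⁻¹ *ᵥ v)‖
      ≤ Real.exp (-(κ * R')) / (gammaU d a' α τ - Jcov (Fintype.card o) d a' α τ κ) * (Real.sqrt (nsq u) * Real.sqrt (nsq v)) := by
  have hγ : 0 < gammaU d a' α τ := (Jcov_nonneg _ _ ha'.le hα κ).trans_lt hJ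
  exact combesThomas_pairwise_inv (scalarOp n M a' R T) (scalarOp_isHermitian n M a' R T) (isUnit_scalarOp n M ha' hα hτ hR hT hγ)
    (siteW n M ρ₀) (coercive_scalarOp n M ha' hα hτ hR hT) (ctRowDefect_scalarOp_le_uniform n M ha'.le hα hτ hR hT hlip hosc) hκ hJ
    hu hv

/-! ## §2 Set-to-set and entry forms in unit-lattice distance -/

/-- **SET-TO-SET DECAY in unit-lattice distance**: for a nonempty set `T` of fine sites, `v` supported on `T × o`, `u` supported on
sites at sup distance `≥ nR′` (`≥ R′` blocks) from `T`, and `Jcov κ < γ_U`: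
`|⟨u, S_U⁻¹v⟩| ≤ e^{−κR′}/(γ_U − Jcov κ)·‖u‖‖v‖`. [folklore] -/
theorem scalarOp_inv_setDecay (ha' : 0 < a') (hα : 0 ≤ α) (hτ : 0 ≤ τ) (h2 : ∀ μ, 2 ≤ fine n M μ)
    (hR : ∀ μ x, ‖connS (fine n M) ((n : ℕ) : ℂ) R μ x‖ ≤ α) (hT : ∀ x, ‖T x - 1‖ ≤ τ)
    (Ts : Finset (Tor (fine n M))) (hTs : Ts.Nonempty) {κ R' : ℝ} (hκ : 0 ≤ κ) (hJ : Jcov (Fintype.card o) d a' α τ κ < gammaU d a' α τ)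
    {u v : Tor (fine n M) × o → ℂ} (hv : ∀ e, v e ≠ 0 → e.1 ∈ Ts)
    (hu : ∀ e, u e ≠ 0 → ∀ t ∈ Ts, (n : ℝ) * R' ≤ ldist (fine n M) e.1 t) :
    ‖star u ⬝ᵥ ((scalarOp n M a' R T)⁻¹ *ᵥ v)‖
      ≤ Real.exp (-(κ * R')) / (gammaU d a' α τ - Jcov (Fintype.card o) d a' α τ κ) * (Real.sqrt (nsq u) * Real.sqrt (nsq v)) := by
  have hn0 : (0 : ℝ) < n := by exact_mod_cast Nat.pos_of_ne_zero (NeZero.ne n)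
  refine scalarOp_inv_pairing_decay n M ha' hα hτ hR hT (rhoS_lipschitz n M h2 Ts hTs) (rhoS_osc n M Ts hTs) hκ hJ ?_ ?_
  · intro e he
    have h := mul_le_mul_of_nonneg_left (le_distTo (ldist (fine n M)) Ts hTs (hu e he)) (by positivity : (0 : ℝ) ≤ 1 / n)
    have heq : 1 / (n : ℝ) * (n * R') = R' := by field_simp
    rw [heq] at h
    exact h
  · intro e he
    exact mul_nonpos_iff.mpr (Or.inl ⟨by positivity, distTo_le_zero_of_mem (ldist (fine n M)) (ldist_self _) Ts hTs (hv e he)⟩)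

/-- `nsq` of a unit vector. [folklore] -/
theorem nsq_single (e : Tor (fine n M) × o) : nsq (Pi.single e (1 : ℂ) : Tor (fine n M) × o → ℂ) = 1 := by
  unfold nsq
  rw [Finset.sum_eq_single e]
  · simp
  · intro e' _ he'; simp [he']
  · intro h; exact absurd (Finset.mem_univ _) h

/-- **ENTRY DECAY OF `G′(U) = S_U⁻¹` IN UNIT-LATTICE DISTANCE**: with `Jcov κ < γ_U`,
`‖S_U⁻¹((x,α),(x′,α′))‖ ≤ e^{−κ·dist_∞(x,x′)/n}/(γ_U − Jcov κ)` for ALL entries — `dist_∞(x,x′)/n = |x − x′|` is the unit-lattice (block)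
distance; constants depend on `(d, a′, α, τ, card o)` only.  An ℓ²-shadow of the printed kernel bound away from the diagonal (no
short-distance singularity is claimed at the level of entries).
[cite: Balaban1985BackgroundPropagators, Thm 3.1 (3.42) p.397 (entry shadow, one region; route and constants ours)] [folklore] -/
theorem scalarOp_inv_entry_decay (ha' : 0 < a') (hα : 0 ≤ α) (hτ : 0 ≤ τ) (h2 : ∀ μ, 2 ≤ fine n M μ)
    (hR : ∀ μ x, ‖connS (fine n M) ((n : ℕ) : ℂ) R μ x‖ ≤ α) (hT : ∀ x, ‖T x - 1‖ ≤ τ)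
    {κ : ℝ} (hκ : 0 ≤ κ) (hJ : Jcov (Fintype.card o) d a' α τ κ < gammaU d a' α τ) (e e' : Tor (fine n M) × o) :
    ‖(scalarOp n M a' R T)⁻¹ e e'‖
      ≤ Real.exp (-(κ * (ldist (fine n M) e.1 e'.1 / n))) / (gammaU d a' α τ - Jcov (Fintype.card o) d a' α τ κ) := by
  have hn0 : (0 : ℝ) < n := by exact_mod_cast Nat.pos_of_ne_zero (NeZero.ne n)
  have h := scalarOp_inv_setDecay n M ha' hα hτ h2 hR hT {e'.1} (Finset.singleton_nonempty _) hκ hJ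
    (u := Pi.single e (1 : ℂ)) (v := Pi.single e' (1 : ℂ)) (R' := ldist (fine n M) e.1 e'.1 / n)
    (fun i hi => by
      by_contra hne
      exact hi (by rw [Pi.single_apply, if_neg (fun h => hne (by rw [h, Finset.mem_singleton]))]))
    (fun i hi t ht => by
      rw [Finset.mem_singleton] at ht
      have hie : i = e := by by_contra hne; exact hi (by rw [Pi.single_apply, if_neg hne])
      rw [ht, hie]; exact le_of_eq (by field_simp))
  rw [nsq_single, nsq_single, Real.sqrt_one, mul_one, mul_one] at h
  have hentry : star (Pi.single e (1 : ℂ) : Tor (fine n M) × o → ℂ) ⬝ᵥ ((scalarOp n M a' R T)⁻¹ *ᵥ Pi.single e' 1)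
      = (scalarOp n M a' R T)⁻¹ e e' := by
    rw [Matrix.mulVec_single_one, ← Pi.single_star, star_one, single_dotProduct, one_mul, Matrix.col_apply]
  rwa [hentry] at h

/-! ## §3 The closed form at the explicit rate `κ_U` -/

/-- **ENTRY DECAY OF `G′(U)`, CLOSED FORM**: in the small-field regime `γ_U = γ′/2 − (dα)² − a′τ(2+τ) > 0`, for EVERY level `n = L^j`,
every torus with `n·M_μ ≥ 2`, every connection with `‖n(R − 1)‖ ≤ α` and site transports with `‖T − 1‖ ≤ τ`, and all entries:
`‖S_U⁻¹((x,α),(x′,α′))‖ ≤ (2/γ_U)·e^{−κ_U·dist_∞(x,x′)/n}` with `κ_U = kappaU (card o) d a′ α τ > 0` — the quantifier shape of [B9] Thm 3.1's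
«δ₀, B₀ depending on d only» (here: on `(d, a′, α, τ, card o)`), for the one-region model.
[cite: Balaban1985BackgroundPropagators, Thm 3.1 (3.42) p.397 (entry shadow, one region; route and constants ours)] [folklore] -/
theorem scalarOp_inv_entry_decay_explicit (ha' : 0 < a') (hα : 0 ≤ α) (hτ : 0 ≤ τ) (h2 : ∀ μ, 2 ≤ fine n M μ)
    (hR : ∀ μ x, ‖connS (fine n M) ((n : ℕ) : ℂ) R μ x‖ ≤ α) (hT : ∀ x, ‖T x - 1‖ ≤ τ) (hγ : 0 < gammaU d a' α τ)
    (e e' : Tor (fine n M) × o) :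
    ‖(scalarOp n M a' R T)⁻¹ e e'‖
      ≤ 2 / gammaU d a' α τ * Real.exp (-(kappaU (Fintype.card o) d a' α τ * (ldist (fine n M) e.1 e'.1 / n))) := by
  have hJ := Jcov_kappaU_le (Fintype.card o) d ha'.le hα hγ
  have hJ' : Jcov (Fintype.card o) d a' α τ (kappaU (Fintype.card o) d a' α τ) < gammaU d a' α τ := by linarith
  refine (scalarOp_inv_entry_decay n M ha' hα hτ h2 hR hT (kappaU_pos _ d ha'.le hα hγ).le hJ' e e').trans ?_
  rw [div_eq_mul_inv, mul_comm]
  refine mul_le_mul_of_nonneg_right ?_ (Real.exp_pos _).le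
  rw [div_eq_mul_inv, show (2 : ℝ) * (gammaU d a' α τ)⁻¹ = (gammaU d a' α τ / 2)⁻¹ by rw [inv_div]; ring]
  exact inv_anti₀ (by linarith) (by linarith)

end Summit.QuantumFields.BalabanUV.T4Continuum.ScalarCovariantGreenDecay

end
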